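import Summits.ResolutionOfSingularities.ResolutionOfSingularities.Theorems.EquisingularLiftEquisingularLiftNatTCPlusMemberCentred
import Summits.ResolutionOfSingularities.ResolutionOfSingularities.Theorems.EquisingularLiftEquisingularLiftNatCentredPackageFrameOver
import Summits.ResolutionOfSingularities.ResolutionOfSingularities.Theorems.EquisingularLiftEquisingularLiftNatClusterConeLiftAt
import HarnessLib

/-!
# [OURS · L1 W4.5(b) · EL♮(3)] (δ) D4 — THE CENTRED PACKAGE AT A POINT OF A CLUSTER
# (`TCPlus.CentredPackage` at `j₂ y′_t` for the strict-transform pair of the ONE cluster cone `K₀`; res-type-100's B8 chain per point,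
# with the (δ) D2/D4 tuple in place of B4a★ and B6c under the pointed chart clauses)
# (crux `EquisingularLiftNatThree` stmt-ResolutionOfSingularities-20148 / parent 20038; rung v7′ TC⁺⁺, STEP 0 per subset)

NOT a statement of any manuscript. Helper file of the chain res-L1-w45b (cell `res-hironaka`, LADDER-RESOLUTION rung L, slot W4.5(b));
OURS; AI-written, weaker than expert review; `--supports stmt-ResolutionOfSingularities-20148 --as helper` by res-L1-w45b-stub-3 (brick D4 of
`L/res-L1-w45b-stub-3/DELTA-PLAN.md`, the per-point PACKAGE; res-L1-w45b-plan-1 BOOKING 2026-08-27T16:20:41Z). No `sorry`; standard axioms;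
no definitions.

WHAT. **`tcPlus_centredPackage_clusterPoint`**: in res-type-100's B8 context (`tcPlus_member_centred`, p547231: model squares over the DVR
`O ↠ k`, the section `s` through `j x`, the blow-up `τ₁` of `ker s`, the point blow-up `υ` downstairs with `j₂ ≫ τ₁ = υ ≫ j`), given a
section frame `c` at `j x`, a point `y′` of the cluster read on chart `i` with lifted coordinates `ã` (res-type-100's (δ) D3a presentation,
translated clause), the D2-adapted frame `c'` (`hc'0 / hc's`), the cluster cone `Φ_S` with (δ) D1's clauses AT the point (centred, exact,
strict-transform charts with pointed regularity) and ONE cone divisor `K₀` with germ `Φ_S(c)` at `j x`, the pair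
`(ker s · 𝒪_{X₁}, St K₀)` carries a `TCPlus.CentredPackage` at `j₂ y′`. Chain: (δ) D4 tuple `exists_clusterConeLift_at` → B6a
`exists_conePoint_presentation` (p541628) → axis divisors (…NatPrescribedGermDivisor) → B6b `exists_axisSection_conePoint` (p545343) → T-DIM
→ B6c `tcPlus_centredPackage_of_axisSection_over` (p550804), the cone germ rewritten by `Φ'(c') = Φ_S(c)`. This is clause (vi) of the
subset member `Member … (y′ '' S)` of (δ) D5 at each of its points.

References: res-type-100 p547231 (B8, whose lines this file follows), p541628, p546008; res-D-pv-029 / res-D-pv-051 p545343; res-L1-w45b-stub-3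
…NatClusterConeLiftAt, p550804. U. Görtz, T. Wedhorn, *Algebraic Geometry I* (2020), Prop. 13.91, 13.96 [cite: GortzWedhorn2020];
H. Matsumura, *Commutative Ring Theory* (1986), Thm. 14.2 [cite: Matsumura1987].
-/

set_option linter.dupNamespace false -- mandated namespace `Summit.<Summit>.<Problem>` of this single-conjunct summit
set_option linter.overlappingInstances false -- the binders carry `[IsDomain O] [IsDiscreteValuationRing O]`

noncomputable section

open CategoryTheory CategoryTheory.Limits AlgebraicGeometry TopologicalSpace IsLocalRing MvPolynomial
open Literature.AlgebraicGeometry.Resolution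
open AlgebraicGeometry.Scheme.IdealSheafData
open Summit.ResolutionOfSingularities.ResolutionOfSingularities.Cruxes.EquisingularLift.StrataSplit
open Summit.ResolutionOfSingularities.ResolutionOfSingularities.Cruxes.EquisingularLiftNat.Sections

namespace Summit.ResolutionOfSingularities.ResolutionOfSingularities.Cruxes.EquisingularLiftNat.Sections.TCPlus

set_option maxHeartbeats 800000 in -- long assembly over the chart algebra `blowupAlgebra` (slow instance unification, cf. p547231)
/-- **(δ) D4 — the centred package at a point of a cluster.** See the module docstring. [cite: GortzWedhorn2020, Prop. 13.91]
[OURS · L1 W4.5b] (δ) D4; NOT a statement of the manuscript. -/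
theorem tcPlus_centredPackage_clusterPoint (k : Type) [Field k] [IsAlgClosed k] (O : Type) [CommRing O] [IsDomain O]
    [IsDiscreteValuationRing O] [IsAdicComplete (IsLocalRing.maximalIdeal O) O] [IsAlgClosed (IsLocalRing.ResidueField O)]
    (θ : O →+* k) (hθ : Function.Surjective θ) (P : Scheme.{0}) (q : P ⟶ Spec (.of O)) [IsProper q]
    (X' : Scheme.{0}) (σ' : X' ⟶ P) [IsProper σ'] [IsIntegral X'] [IsLocallyNoetherian X'] (hX'reg : Scheme.IsRegular X')
    (F₁ : Scheme.{0}) (j : F₁ ⟶ X') (t : F₁ ⟶ Spec (.of k))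
    (hsq : IsPullback j t (σ' ≫ q) (Spec.map (CommRingCat.ofHom θ))) (x : F₁) (hx : IsClosed ({x} : Set F₁))
    (s : Spec (.of O) ⟶ X') (hs : s ≫ σ' ≫ q = 𝟙 _) (hsx : s (IsLocalRing.closedPoint O) = j x)
    (hdim : ringKrullDim (X'.presheaf.stalk (j x)) = ((3 + 1 : ℕ) : WithBot ℕ∞))
    (X₁ : Scheme.{0}) (τ₁ : X₁ ⟶ X') (hτ₁ : IsBlowup τ₁ s.ker) [IsIntegral X₁] [IsLocallyNoetherian X₁]
    (hX₁reg : Scheme.IsRegular X₁)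
    (F₂ : Scheme.{0}) (υ : F₂ ⟶ F₁) (hυ : IsBlowup υ (vanishingIdeal (⟨{x}, hx⟩ : Closeds F₁)))
    (j₂ : F₂ ⟶ X₁) (t₂ : F₂ ⟶ Spec (.of k)) (hsq₂ : IsPullback j₂ t₂ ((τ₁ ≫ σ') ≫ q) (Spec.map (CommRingCat.ofHom θ)))
    (hcomm : j₂ ≫ τ₁ = υ ≫ j) (hcarrier : (s.ker.comap τ₁).comap j₂ = (vanishingIdeal (⟨{x}, hx⟩ : Closeds F₁)).comap υ)
    -- the section frame at `j x`, the point's chart `i`, its lifted coordinates `ã`, the D2-adapted frame `c'`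
    (ϖ : O) (hϖ : Irreducible ϖ)
    (c : Fin 3 → X'.presheaf.stalk (j x)) (hcI : Ideal.span (Set.range c) = stalkIdeal s.ker (j x))
    (i : Fin 3) (a : {l : Fin 3 // l ≠ i} → O) (c' : Fin 3 → X'.presheaf.stalk (j x)) (hc'0 : c' 0 = c i)
    (hc's : ∀ l : Fin 2, c' l.succ = c (i.succAbove l) -
      ((Scheme.ΓSpecIso (.of O)).inv ≫ (σ' ≫ q).appTop ≫ X'.presheaf.Γgerm (j x)).hom (a ⟨i.succAbove l, Fin.succAbove_ne i l⟩) *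
        c i)
    -- the cluster point and its (δ) D3a presentation on chart `i` of `c̄`, translated by `ã`
    (y' : F₂) (hy'x : υ y' = x) (hy'c : IsClosed ({y'} : Set F₂))
    (Hp : ∃ (𝔮 : PrimeSpectrum (blowupAlgebra (Ideal.span (Set.range fun l => (j.stalkMap x).hom (c l)))
        ((j.stalkMap x).hom (c i))))
      (χ : blowupAlgebra (Ideal.span (Set.range fun l => (j.stalkMap x).hom (c l))) ((j.stalkMap x).hom (c i)) →+*
        F₂.presheaf.stalk y')
      (e : F₂.presheaf.stalk y' ≃+* Localization.AtPrime 𝔮.asIdeal),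
      (∀ r, χ (algebraMap _ _ r) = ((F₁.presheaf.stalkCongr (Inseparable.of_eq hy'x)).inv ≫ υ.stalkMap y').hom r) ∧
      @IsLocalization.AtPrime _ _ (F₂.presheaf.stalk y') _ χ.toAlgebra 𝔮.asIdeal _ ∧
      (∀ b, e (χ b) = algebraMap _ (Localization.AtPrime 𝔮.asIdeal) b) ∧
      𝔮.asIdeal.comap (algebraMap _ (blowupAlgebra (Ideal.span (Set.range fun l => (j.stalkMap x).hom (c l)))
        ((j.stalkMap x).hom (c i)))) = maximalIdeal (F₁.presheaf.stalk x) ∧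
      ∀ l : {l : Fin 3 // l ≠ i}, blowupAlgebra.frac (fun l => (j.stalkMap x).hom (c l)) i l.1 -
        algebraMap _ _ ((j.stalkMap x).hom
          (((Scheme.ΓSpecIso (.of O)).inv ≫ (σ' ≫ q).appTop ≫ X'.presheaf.Γgerm (j x)).hom (a l))) ∈ 𝔮.asIdeal)
    -- the cluster cone `Φ_S` and (δ) D1's clauses at the point
    {d m : ℕ} (Φ : MvPolynomial (Fin 3) O) (hm1 : 1 ≤ m) (hΦd : Φ.IsHomogeneous d)
    (hcen : dehomogenize i Φ ∈ (Ideal.span (Set.range fun l => (X l : MvPolynomial {l : Fin 3 // l ≠ i} O) - C (a l))) ^ m)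
    (hexact : ∃ α : {l : Fin 3 // l ≠ i} →₀ ℕ, α.degree = m ∧
      IsUnit (coeff α (aeval (fun l => (X l : MvPolynomial {l : Fin 3 // l ≠ i} O) + C (a l)) (dehomogenize i Φ))))
    (hst : ∀ p : {l : Fin 3 // l ≠ i}, ∃ Φst : MvPolynomial {l : Fin 3 // l ≠ i} O,
      (X p : MvPolynomial {l : Fin 3 // l ≠ i} O) ^ m * Φst =
        aeval (fun l => if l = p then (X p : MvPolynomial {l : Fin 3 // l ≠ i} O) else X p * X l)
          (aeval (fun l => (X l : MvPolynomial {l : Fin 3 // l ≠ i} O) + C (a l)) (dehomogenize i Φ)) ∧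
      ∀ (Q : Ideal (MvPolynomial {l : Fin 3 // l ≠ i} O ⧸ Ideal.span {Φst})) [Q.IsPrime],
        Ideal.Quotient.mk (Ideal.span {Φst}) (C ϖ : MvPolynomial {l : Fin 3 // l ≠ i} O) ∈ Q →
        Ideal.Quotient.mk (Ideal.span {Φst}) (X p : MvPolynomial {l : Fin 3 // l ≠ i} O) ∈ Q →
        IsRegularLocalRing (Localization.AtPrime Q))
    -- ONE cone divisor for the subset: germ `Φ_S(c)` at `j x`
    (K₀ : X'.IdealSheafData) (hK₀ : stalkIdeal K₀ (j x) = Ideal.span {MvPolynomial.eval c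
      (MvPolynomial.map ((Scheme.ΓSpecIso (.of O)).inv ≫ (σ' ≫ q).appTop ≫ X'.presheaf.Γgerm (j x)).hom Φ)}) :
    TCPlus.CentredPackage O P q X₁ (τ₁ ≫ σ') (s.ker.comap τ₁) (strictTransformIdeal τ₁ s.ker K₀) (j₂ y') := by
  classical
  -- closed immersions of the model squares, Noetherianity of the fibres, properness of the blow-up
  haveI : IsProper τ₁ := hτ₁.isProper
  haveI : IsClosedImmersion (Spec.map (CommRingCat.ofHom θ)) := IsClosedImmersion.spec_of_surjective _ hθ
  haveI : IsClosedImmersion j := MorphismProperty.IsStableUnderBaseChange.of_isPullback hsq.flip inferInstance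
  haveI : IsClosedImmersion j₂ := MorphismProperty.IsStableUnderBaseChange.of_isPullback hsq₂.flip inferInstance
  haveI : IsLocallyNoetherian F₁ := LocallyOfFiniteType.isLocallyNoetherian j
  haveI : IsLocallyNoetherian F₂ := by
    haveI : IsProper υ := hυ.isProper
    exact LocallyOfFiniteType.isLocallyNoetherian υ
  have hsq₂' : IsPullback j₂ t₂ (τ₁ ≫ σ' ≫ q) (Spec.map (CommRingCat.ofHom θ)) := by
    simpa only [Category.assoc] using hsq₂
  have hpc : τ₁ (j₂ y') = j x := by rw [← Scheme.Hom.comp_apply, hcomm, Scheme.Hom.comp_apply, hy'x]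
  -- (δ) D4: the B4a★-shaped tuple for `(c', Φ' = Φ_S ∘ θ)`
  refine (exists_clusterConeLift_at O (σ' ≫ q) s hs j x hsx (hX'reg (j x)) hdim ϖ hϖ υ y' hy'x c hcI i a c' hc'0 hc's Hp Φ
    hΦd hcen hexact hst).elim fun θR H => H.elim fun Φ' H => H.elim fun Φu H => H.elim fun Φv H => ?_
  have hcI' := H.1
  have hqr' := H.2.1
  have hdom' := H.2.2.1
  have hθR' := H.2.2.2.1
  have h𝔪' := H.2.2.2.2.1
  have hϖc' := H.2.2.2.2.2.1
  have Hp' := H.2.2.2.2.2.2.1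
  have hΦ'd := H.2.2.2.2.2.2.2.1
  have hΦ'cen := H.2.2.2.2.2.2.2.2.1
  have hΦ'exact := H.2.2.2.2.2.2.2.2.2.1
  have hΦ'ι := H.2.2.2.2.2.2.2.2.2.2.2.1
  have heval := H.2.2.2.2.2.2.2.2.2.2.2.2.2.1
  have hΦu := H.2.2.2.2.2.2.2.2.2.2.2.2.2.2.1
  have hΦv := H.2.2.2.2.2.2.2.2.2.2.2.2.2.2.2.1
  have hregu := H.2.2.2.2.2.2.2.2.2.2.2.2.2.2.2.2.1
  have hregv := H.2.2.2.2.2.2.2.2.2.2.2.2.2.2.2.2.2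
  clear H
  haveI := hdom'
  haveI : IsRegularRing (X'.presheaf.stalk (j x) ⧸ Ideal.span (Set.range c')) := IsRegularRing.of_ringEquiv θR.symm
  -- the model frame downstairs
  have hϖO : ϖ ∈ maximalIdeal O := by rw [hϖ.maximalIdeal_eq]; exact Ideal.mem_span_singleton_self ϖ
  have hcb𝔪' := span_stalkMap_eq_maximalIdeal_of_model θ hθ (σ' ≫ q) j t hsq x ϖ hϖO c' h𝔪'
  have hcbar' := isQuasiRegular_stalkMap_model O k θ hθ (σ' ≫ q) j t hsq x c' hqr' ϖ hϖ hϖc'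
  -- B6a: the chart-`0` presentation of `𝒪_{X₁,j₂ y′}` in the adapted frame
  obtain ⟨𝔔₁, χ₁, -, hχ₁, hloc₁, -, h𝔔₁, hu⟩ :=
    exists_conePoint_presentation hτ₁ j hx hυ j₂ hcomm hcarrier c' hcI' hcb𝔪' y' hy'x hpc Hp'
  -- the section centre through `j x`; the axis divisors of the adapted frame
  obtain ⟨-, hsreg, -, hsupp⟩ := section_isClosedImmersion_and_isRegular_ker O X' (σ' ≫ q) s hs
  have hpJ : j x ∈ (s.ker.support : Set X') := by rw [hsupp, ← hsx]; exact Set.mem_range_self _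
  have hItop : Ideal.span (Set.range c') ≠ ⊤ := by
    rw [hcI']
    exact ne_top_of_le_ne_top (Ideal.IsMaximal.ne_top (IsLocalRing.maximalIdeal.isMaximal _))
      ((mem_support_iff_stalkIdeal_le _ _).mp hpJ)
  obtain ⟨L₁, -, hL₁⟩ := exists_forall_isPrincipal_stalkIdeal_eq_span hX'reg (j x) (ne_zero_of_isQuasiRegular hqr' hItop 1)
  obtain ⟨L₂, -, hL₂⟩ := exists_forall_isPrincipal_stalkIdeal_eq_span hX'reg (j x) (ne_zero_of_isQuasiRegular hqr' hItop 2)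
  -- B6b: the axis section through the cluster point
  obtain ⟨s_c, hsc, hpt, hle, hstk, -, -⟩ := exists_axisSection_conePoint O k θ hθ (σ' ≫ q) s hs hτ₁ j hx hυ j₂ hcomm t₂ hsq₂'
    hsx c' hcI' hqr' θR hcb𝔪' hcbar' L₁ L₂ hL₁ hL₂ y' hy'x hy'c hpc 𝔔₁ χ₁ hχ₁ hloc₁ h𝔔₁ hu Hp'
  -- T-DIM at the closed point `j₂ y′`
  have hcl₁ : IsClosed ({j₂ y'} : Set X₁) := by
    simpa only [Set.image_singleton] using j₂.isClosedEmbedding.isClosedMap _ hy'c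
  have hdim₁ : ringKrullDim (X₁.presheaf.stalk (j₂ y')) = ((3 + 1 : ℕ) : WithBot ℕ∞) := by
    have hUC := isUniversallyCatenaryRing_stalk_of_locallyOfFiniteType (isUniversallyCatenaryRing_of_isDiscreteValuationRing O)
      (σ' ≫ q) (τ₁.base (j₂ y'))
    rw [ringKrullDim_stalk_eq_of_isBlowup_of_isClosed hτ₁ hcl₁ hUC]
    change ringKrullDim (X'.presheaf.stalk (τ₁ (j₂ y'))) = _
    rw [hpc]
    exact hdim
  -- the cone germ in the adapted frame: `Φ'(c') = Φ_S(c)`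
  have hK₀' : stalkIdeal K₀ (j x) = Ideal.span {MvPolynomial.eval c'
      (MvPolynomial.map ((Scheme.ΓSpecIso (.of O)).inv ≫ (σ' ≫ q).appTop ≫ X'.presheaf.Γgerm (j x)).hom Φ')} := by
    rw [hK₀, heval]
  -- B6c under the pointed chart clauses
  exact tcPlus_centredPackage_of_axisSection_over O ϖ hϖ P q σ' (σ' ≫ q) K₀ (j₂ y') (j x) hpc hpJ c' hcI' hqr' θR hθR' h𝔪'
    𝔔₁ χ₁ hχ₁ hloc₁ h𝔔₁ hu (hX₁reg (j₂ y')) hdim₁ s_c (by simpa only [Category.assoc] using hsc) hpt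
    (le_sup_left.trans (le_sup_left.trans hle)) hstk Φ' hm1 hΦ'd hΦ'cen hΦ'exact hΦ'ι hK₀' Φu Φv hΦu hΦv hregu hregv

end Summit.ResolutionOfSingularities.ResolutionOfSingularities.Cruxes.EquisingularLiftNat.Sections.TCPlus

end
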